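import Literature.Algebra.Lie.LefschetzModuleSL2RepresentationFunctoriality
import Literature.Algebra.Lie.LefschetzModuleKleimanAlgebraGrading
import Literature.Algebra.Lie.LefschetzModuleWeylOperatorSelfAdjoint
import HarnessLib

/-!
# Transposition IS matrix transposition for the `SL₂(K)`-representation of a Lefschetz module: if `(e, ᶜΛ)` and `(ᶜΛ, e)` are
# adjoint pairs for a bilinear form `B`, then `B(ρ(γ) x, y) = B(x, ρ(γᵀ) y)` for every `γ ∈ SL₂(K)`
# (André 1996, Prop. 1.2, last clause, at the level of the GROUP; the Weyl element is a `B`-isometry; `K[e, ᶜΛ] ∩ {h}'` is self-adjoint)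

Topic `Literature/Algebra/Lie` (namespace `Literature.Algebra.Lie`). Lane `lit-hodgefound` (Track 2 foundations library), prover seat
`lit-hodgefound-p35` (generation 49, row g49-#1). PROVED theorems only (no definition, no named fact, no `sorry`, no instance, no notation;
D-0026 net debt `0`). A sequel of `LefschetzModuleSL2Representation` (p34/p08: Beauville's `ρ = sl2Rep : SL(2, K) →* End_K(M)`,
`(1 a ; 0 1) ↦ exp(a e)`, `(1 0 ; a 1) ↦ exp(a ᶜΛ)`, `(0 −1 ; 1 0) ↦ w`, `diag(t, t⁻¹) ↦ tʰ`), of `LefschetzModuleSL2RepresentationFunctoriality`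
§4 (`isAdjointPair_exp`; the POINCARÉ-TYPE case `h` skew, `e` self-adjoint: `ρ(a b ; c d)† = ρ(d b ; c a)`, `isAdjointPair_sl2Rep_of_coe_eq`),
of `LefschetzModuleSelfAdjoint` (`isAdjointPair_of_strings`) and of `LefschetzModuleKleimanAlgebraGrading` (the degree-`0` part of `K[e, ᶜΛ]`
acts on every piece `eᵃ P_{−k}` by a scalar, `mem_adjoin_pair_dual_and_commute_iff_forall_exists_smul`).

THE POINT. André's Proposition 1.2 says that, under the isomorphism `K[L, ᶜΛ] ≅ ⊕ₖ M_{k+1}(K)`, "la transposition relative à la forme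
bilinéaire `(x, y) ↦ ∫ x ∪ *y` correspond à la transposition des matrices" — the generators `L` and `*L* = const·ᶜΛ` "s'échangent par la
transposition". This file isolates the abstract mechanism behind the GROUP-LEVEL form of that sentence and proves it: call a bilinear form
`B` on the Lefschetz module `(M, h, e)` OF WEYL TYPE when `e` and `f = ᶜΛ` are mutually adjoint BOTH ways,
`B(e x, y) = B(x, f y)` and `B(f x, y) = B(x, e y)` (for the Poincaré pairing `∫ x ∪ y` one has instead `eᵀ = e`, `fᵀ = f`, `hᵀ = −h`; André's
twist by `* = *_H`, or by the Weyl element `w = ± *_H`, converts the one into the other: on a complex torus the form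
`Q_w(x, y) = (−1)^{k(k−1)/2} ∫_X w(x) ∧ y` of `ComplexTorusWeylPairingTransposition` is of Weyl type). Then:
* `hᵀ = h` (`h = [e, f]`), so `B(M_m, M_n) = 0` for `m ≠ n`;
* **`ρ(γ)ᵀ = ρ(γᵀ)` for every `γ ∈ SL₂(K)`** (`ρ` of the transvection `1 + cE₀₁` is `exp(c e)`, of its transpose `1 + cE₁₀` is `exp(c f)`, and
  `SL₂(K)` is generated by transvections — Mathlib's `Matrix.SL2.transvection_induction`); in particular `exp(c e)ᵀ = exp(c f)`,
  `(tʰ)ᵀ = tʰ`, and **`wᵀ = w³ = w⁻¹`: the Weyl element is a `B`-ISOMETRY**, as is `ρ(γ)` for every `γ` with `γᵀγ = 1`;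
* the Lefschetz algebra `K[e, f]` is stable under `B`-transposition, and **every element of its degree-`0` part `K[e, f] ∩ {h}'`** (the span
  of the projectors onto the pieces `eᵃ P_{−k}`: Kleiman's `pʲ`, the Lefschetz–Künneth projectors) **is `B`-self-adjoint** — distinct pieces
  `eᵃ P_{−k} ⊥_B e^{a'} P_{−k'}` being `B`-orthogonal.

## What is proved (`L : HasLefschetzProperty h e`, `hgr : IsZGrading h`, `f = L.dual hgr`, `ρ = L.sl2Rep hgr`, `w = L.weylOperator hgr`;
`hef : IsAdjointPair B B e f`, `hfe : IsAdjointPair B B f e`; `M` finite-dimensional over a field `K` of characteristic `0`)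

* §1 `isSelfAdjoint_h_of_isAdjointPair` (`hᵀ = h`), `apply_eq_zero_of_isSelfAdjoint_of_mem_degreeSpace` (`B(M_m, M_n) = 0`, `m ≠ n`),
  `isAdjointPair_exp_smul_e_exp_smul_dual` / `isAdjointPair_exp_smul_dual_exp_smul_e` (`exp(c e)ᵀ = exp(c f)`, `exp(c f)ᵀ = exp(c e)`).
* §2 **`isAdjointPair_sl2Rep_transpose`: `B(ρ(γ) x, y) = B(x, ρ(γᵀ) y)`** for all `γ ∈ SL(2, K)`; `isOrthogonal_sl2Rep_of_transpose_mul_self`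
  (`γᵀγ = 1 ⇒ B(ρ(γ)x, ρ(γ)y) = B(x, y)`), `isSelfAdjoint_sl2Rep_of_transpose_eq` (`γᵀ = γ ⇒ ρ(γ)` self-adjoint),
  `isAdjointPair_weylOperator_pow_three` (`wᵀ = w³`), **`isOrthogonal_weylOperator`** (`B(wx, wy) = B(x, y)`), `isSelfAdjoint_weylOperator_sq`,
  `isSelfAdjoint_torus` (`(tʰ)ᵀ = tʰ`, `t ≠ 0`).
* §3 `exists_isAdjointPair_of_mem_adjoin_of_forall_exists` (generic: a subalgebra whose generators have adjoints inside it is stable under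
  transposition), `exists_isAdjointPair_of_mem_adjoin_pair_dual_of_isAdjointPair` (`K[e, f]` is stable under `B`-transposition).
* §4 `apply_pow_primitive_pow_primitive_eq_zero_of_isAdjointPair` (**string vectors `eⁱ p`, `eⁱ' p'` (`p ∈ P_{−k}`, `p' ∈ P_{−k'}`) are
  `B`-orthogonal unless `k = k'` and `i = i'`**), **`isSelfAdjoint_of_mem_adjoin_pair_dual_of_commute`** (`T ∈ K[e, f]`, `[h, T] = 0 ⇒ Tᵀ = T`),
  `isSelfAdjoint_stringUnit_diag` (the projectors `E⁽ᵏ⁾_{aa}` onto `eᵃ P_{−k}` are self-adjoint).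
* §5 (appended, row g49-#4) ANDRÉ'S OWN FORM `B⋆(x, y) = B(x, *_H y)` FOR A POINCARÉ-TYPE PAIRING `B` (`h` skew, `e` self-adjoint) IS OF WEYL TYPE (p34's
  `isAdjointPair_compl₂_andreHodgeInvolution` / `…'`: `eᵀ = ᶜΛ`, `ᶜΛᵀ = e` for `B⋆`), so everything above applies to it verbatim:
  **`isAdjointPair_compl₂_andreHodgeInvolution_sl2Rep_transpose` (`B(ρ(γ)x, *_H y) = B(x, *_H ρ(γᵀ) y)` — Prop. 1.2's last clause for `* = *_H` at the level of
  the group)**, `isSelfAdjoint_compl₂_andreHodgeInvolution_h`, `isOrthogonal_compl₂_andreHodgeInvolution_sl2Rep_of_transpose_mul_self`,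
  `isOrthogonal_compl₂_andreHodgeInvolution_weylOperator` (`w` is a `B⋆`-isometry), `apply_pow_primitive_andreHodgeInvolution_pow_primitive_eq_zero` (the pieces
  `eⁱ P_{−k}` are `B⋆`-orthogonal), `isSelfAdjoint_compl₂_andreHodgeInvolution_of_mem_adjoin_pair_dual_of_commute` (the degree-`0` part of `K[e, f]` is `B⋆`-symmetric).

## Source, VERBATIM

* Y. André, *Pour une théorie inconditionnelle des motifs*, Publ. Math. IHÉS **83** (1996) [Andre1996Motifs] (held `paper:doi-10-1007-bf02698643`),
  §1.2 (p. 11 = p0008 L27–L37): "Alors `(ᶜΛ, h, −L)` forme un `𝔰𝔩₂`-triplet […] On en déduit une représentation de `𝔰𝔩₂` sur `H•(X)`, attachée à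
  `η` : `ᶜΛ ↦ (0 1 ; 0 0)`, `L ↦ (0 0 ; 1 0)`, `h ↦ (1 0 ; 0 −1)`" (the tree's `sl2Rep` uses the transposed convention `e ↦ (0 1 ; 0 0)`; the
  statement `ρ(γ)ᵀ = ρ(γᵀ)` is insensitive to this); Prop. 1.2 (p. 11 = p0008 L62–L66): "Les sous-algèbres `ℚ[L, *_L]`, `ℚ[L, *_H]`,
  `ℚ[L, ᶜL, *_L]`, `ℚ[L, ᶜΛ]` de `End H(X)` sont égales et contiennent les projecteurs de Künneth. De plus, ces algèbres sont canoniquement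
  isomorphes à une somme d'algèbres matricielles […]. Via cet isomorphisme, la transposition relative à la forme bilinéaire `(x, y) ↦ ∫ x ∪ *y`
  correspond à la transposition des matrices, pour `* = *_L` ou `*_H`."; proof (p. 12 = p0009 L13–L15): "Quant à la dernière assertion, il
  suffit de la tester sur les générateurs `L` et `*_L L *_L`. Comme ces générateurs s'échangent par la transposition, c'est clair."
* E. Looijenga, V. A. Lunts, *A Lie algebra attached to a projective variety*, Invent. Math. **129** (1997) [LooijengaLunts1997], §1 (1.3) p. 5
  ("So `𝔤(𝔞, M)` is then a subalgebra of `aut(M, φ)`" — the skew case, integrated in `sl2Rep_isOrthogonal`).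
* A. Beauville, *The action of SL₂ on abelian varieties*, J. Ramanujan Math. Soc. **25** (2010) [Beauville2010SL2], §3 Theorem (the
  presentation of `ρ` on unipotents, torus and Weyl element).
* R. Goodman, N. R. Wallach, *Symmetry, Representations, and Invariants*, GTM 255 [GoodmanWallachGTM255], §4.1.5 (4.6)–(4.8), §5.5.2
  Cor. 5.5.16 (the degree-`0` part is the commutative span of the piece projectors — via `LefschetzModuleKleimanAlgebraGrading`).

## Scope

Bilinear `B : M →ₗ M →ₗ K` arbitrary (no symmetry, no non-degeneracy); `h`-self-adjointness is DERIVED from the two adjoint-pair hypotheses.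
The carrier reading (`M = H•(X; ℂ)` of a complex torus, `B` the graded Weyl–Voisin form `Σₖ (−1)^{k(k−1)/2} ∫_X w(x_k) ∧ y_k`) is the next row.
-/

noncomputable section

namespace Literature.Algebra.Lie

open Module Function Set
open scoped MatrixGroups
open LinearMap (BilinForm)
open HasLefschetzProperty (primitiveSpace mem_primitiveSpace_iff)

variable {K : Type*} [Field K] [CharZero K] {M : Type*} [AddCommGroup M] [Module K M]
  {B : BilinForm K M} {h e : Module.End K M}

/-! ### §0 Transposition in `SL(2, K)` (bookkeeping) -/

section SL2

omit [CharZero K] in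
/-- `(A B)ᵀ = Bᵀ Aᵀ` in `SL(2, K)`. [folklore] -/
private theorem transpose_mul₉₀ (A C : SL(2, K)) : (A * C).transpose = C.transpose * A.transpose :=
  Subtype.ext (Matrix.transpose_mul _ _)

omit [CharZero K] in
/-- `(1 + c E_{ij})ᵀ = 1 + c E_{ji}`. [folklore] -/
private theorem transpose_transvection₉₀ {i j : Fin 2} (hij : i ≠ j) (c : K) :
    (Matrix.SpecialLinearGroup.transvection hij c).transpose = Matrix.SpecialLinearGroup.transvection hij.symm c := by
  refine Subtype.ext ?_
  rw [Matrix.SpecialLinearGroup.coe_transpose, Matrix.SpecialLinearGroup.transvection_coe,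
    Matrix.SpecialLinearGroup.transvection_coe, Matrix.transpose_add, Matrix.transpose_one, Matrix.transpose_single]

omit [CharZero K] in
/-- `c • a` and `c • b` form an adjoint pair when `a`, `b` do. [folklore] -/
private theorem isAdjointPair_smul₉₀ {a b : Module.End K M} (hab : LinearMap.IsAdjointPair B B a b) (c : K) :
    LinearMap.IsAdjointPair B B (⇑(c • a)) (⇑(c • b)) := fun x y ↦ by
  simp only [LinearMap.smul_apply, map_smul, smul_eq_mul, hab x y]

end SL2

/-! ### §1 Weyl-type forms: `eᵀ = f`, `fᵀ = e` force `hᵀ = h`; degree orthogonality; the unipotents -/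

section WeylType

omit [CharZero K] in
/-- **`B(M_k, M_l) = 0` for `k ≠ l` when `h` is `B`-self-adjoint** (`k·B(x, y) = B(hx, y) = B(x, hy) = l·B(x, y)`, characteristic `0` not
even needed beyond `k ≠ l` in `K`): a Weyl-type form pairs EQUAL degrees, where a Poincaré-type form pairs opposite ones
(`apply_eq_zero_of_isSkewAdjoint_of_mem_degreeSpace`). [cite: LooijengaLunts1997, §1 (1.3) p. 5 ("φ is zero on M_k × M_l unless k + l = 0", the skew case)]
[cite: Andre1996Motifs, Prop. 1.2 (p. 11)] -/
theorem apply_eq_zero_of_isSelfAdjoint_of_mem_degreeSpace [CharZero K] (hh : B.IsSelfAdjoint h) {k l : ℤ} (hkl : k ≠ l) {x y : M}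
    (hx : x ∈ degreeSpace h k) (hy : y ∈ degreeSpace h l) : B x y = 0 := by
  have h1 := hh x y
  rw [mem_degreeSpace_iff.1 hx, mem_degreeSpace_iff.1 hy, map_smul, LinearMap.smul_apply, map_smul, smul_eq_mul, smul_eq_mul,
    ← sub_eq_zero, ← sub_mul, ← Int.cast_sub] at h1
  exact (mul_eq_zero.1 h1).resolve_left (Int.cast_ne_zero.2 (sub_ne_zero.2 hkl))

namespace HasLefschetzProperty

variable [FiniteDimensional K M]

/-- **`hᵀ = h` for a Weyl-type form**: if `B(e x, y) = B(x, f y)` and `B(f x, y) = B(x, e y)` (`f = ᶜΛ`), then `h = [e, f] = ef − fe` is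
`B`-self-adjoint (`(ef)ᵀ = fᵀeᵀ = ef`, `(fe)ᵀ = fe`) — the image `(1 0 ; 0 −1)` of `h` is a symmetric matrix.
[cite: Andre1996Motifs, §1.2 (p. 11, "h ↦ (1 0 ; 0 −1)") and Prop. 1.2 (p. 11)] -/
theorem isSelfAdjoint_h_of_isAdjointPair (L : HasLefschetzProperty h e) (hgr : IsZGrading h)
    (hef : LinearMap.IsAdjointPair B B e (L.dual hgr)) (hfe : LinearMap.IsAdjointPair B B (L.dual hgr) e) : B.IsSelfAdjoint h := by
  intro x y
  have h1 : h = e * L.dual hgr - L.dual hgr * e := by rw [← Ring.lie_def]; exact (L.lie_e_dual hgr).symm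
  rw [h1]
  simp only [LinearMap.sub_apply, Module.End.mul_apply, map_sub]
  rw [hef (L.dual hgr x) y, hfe (e x) y, ← hfe x (L.dual hgr y), ← hef x (e y)]

/-- **`exp(c e)ᵀ = exp(c f)`**: the upper unipotent `ρ(1 c ; 0 1) = exp(c e)` and the lower one `ρ(1 0 ; c 1) = exp(c f)` — images of mutually
TRANSPOSED matrices — form a `B`-adjoint pair (termwise in the finite exponential series). [cite: Andre1996Motifs, Prop. 1.2 (p. 12, proof:
"ces générateurs s'échangent par la transposition")] [cite: Beauville2010SL2, §3 Theorem] -/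
theorem isAdjointPair_exp_smul_e_exp_smul_dual (L : HasLefschetzProperty h e) (hgr : IsZGrading h)
    (hef : LinearMap.IsAdjointPair B B e (L.dual hgr)) (c : K) :
    letI := Algebra.compHom (Module.End K M) (algebraMap ℚ K)
    LinearMap.IsAdjointPair B B (⇑(IsNilpotent.exp (c • e))) (⇑(IsNilpotent.exp (c • L.dual hgr))) :=
  isAdjointPair_exp (L.isNilpotent_smul_e hgr c) (L.isNilpotent_smul_dual hgr c) (isAdjointPair_smul₉₀ hef c)

/-- **`exp(c f)ᵀ = exp(c e)`** (the transposed reading). [cite: Andre1996Motifs, Prop. 1.2 (p. 12, proof)] [cite: Beauville2010SL2, §3 Theorem] -/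
theorem isAdjointPair_exp_smul_dual_exp_smul_e (L : HasLefschetzProperty h e) (hgr : IsZGrading h)
    (hfe : LinearMap.IsAdjointPair B B (L.dual hgr) e) (c : K) :
    letI := Algebra.compHom (Module.End K M) (algebraMap ℚ K)
    LinearMap.IsAdjointPair B B (⇑(IsNilpotent.exp (c • L.dual hgr))) (⇑(IsNilpotent.exp (c • e))) :=
  isAdjointPair_exp (L.isNilpotent_smul_dual hgr c) (L.isNilpotent_smul_e hgr c) (isAdjointPair_smul₉₀ hfe c)

/-! ### §2 `ρ(γ)ᵀ = ρ(γᵀ)`; the Weyl element is a `B`-isometry -/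

/-- **TRANSPOSITION IS MATRIX TRANSPOSITION: `B(ρ(γ) x, y) = B(x, ρ(γᵀ) y)` for every `γ ∈ SL₂(K)`** when `(e, f)` and `(f, e)` are
`B`-adjoint pairs — André's Prop. 1.2 (last clause) at the level of the group: `SL₂(K)` is generated by the transvections `1 + cE₀₁`,
`1 + cE₁₀` (Mathlib's `Matrix.SL2.transvection_induction`), whose images `exp(c e)`, `exp(c f)` are exchanged by transposition exactly as the
matrices are (§1), and `(γ₁γ₂)ᵀ = γ₂ᵀγ₁ᵀ` matches `(ST)ᵀ = TᵀSᵀ`. [cite: Andre1996Motifs, Prop. 1.2 (pp. 11–12, "la transposition […] correspond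
à la transposition des matrices"; proof "il suffit de la tester sur les générateurs")] [cite: Beauville2010SL2, §3 Theorem] -/
theorem isAdjointPair_sl2Rep_transpose (L : HasLefschetzProperty h e) (hgr : IsZGrading h)
    (hef : LinearMap.IsAdjointPair B B e (L.dual hgr)) (hfe : LinearMap.IsAdjointPair B B (L.dual hgr) e) (γ : SL(2, K)) :
    LinearMap.IsAdjointPair B B (L.sl2Rep hgr γ) (L.sl2Rep hgr γ.transpose) := by
  letI := Algebra.compHom (Module.End K M) (algebraMap ℚ K)
  refine Matrix.SL2.transvection_induction (fun γ ↦ LinearMap.IsAdjointPair B B (L.sl2Rep hgr γ) (L.sl2Rep hgr γ.transpose))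
    (fun i j hij c ↦ ?_) (fun γ₁ γ₂ h₁ h₂ ↦ ?_) γ
  · rw [transpose_transvection₉₀ hij c, L.sl2Rep_transvection hgr hij c, L.sl2Rep_transvection hgr hij.symm c]
    split_ifs with hi hj
    · exact absurd (hi.trans hj.symm) hij
    · exact L.isAdjointPair_exp_smul_e_exp_smul_dual hgr hef c
    · exact L.isAdjointPair_exp_smul_dual_exp_smul_e hgr hfe c
    · exact absurd (by fin_cases i <;> fin_cases j <;> simp_all) hij
  · rw [map_mul, transpose_mul₉₀, map_mul]
    exact h₁.mul h₂

/-- Pointwise form: **`B(ρ(γ) x, y) = B(x, ρ(γᵀ) y)`**. [cite: Andre1996Motifs, Prop. 1.2 (pp. 11–12)] -/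
theorem apply_sl2Rep_eq_apply_sl2Rep_transpose (L : HasLefschetzProperty h e) (hgr : IsZGrading h)
    (hef : LinearMap.IsAdjointPair B B e (L.dual hgr)) (hfe : LinearMap.IsAdjointPair B B (L.dual hgr) e) (γ : SL(2, K)) (x y : M) :
    B (L.sl2Rep hgr γ x) y = B x (L.sl2Rep hgr γ.transpose y) :=
  L.isAdjointPair_sl2Rep_transpose hgr hef hfe γ x y

/-- **`γᵀγ = 1 ⇒ ρ(γ)` is a `B`-ISOMETRY: `B(ρ(γ) x, ρ(γ) y) = B(x, y)`** (`B(ρ(γ)x, ρ(γ)y) = B(x, ρ(γᵀγ) y)`): the "orthogonal" elements of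
`SL₂(K)` — `±1`, the Weyl element `(0 −1 ; 1 0)`, the rotations `(a −b ; b a)`, `a² + b² = 1` — act by isometries of every Weyl-type form.
[cite: Andre1996Motifs, Prop. 1.2 (pp. 11–12)] [cite: LooijengaLunts1997, §1 (1.3) p. 5] -/
theorem isOrthogonal_sl2Rep_of_transpose_mul_self (L : HasLefschetzProperty h e) (hgr : IsZGrading h)
    (hef : LinearMap.IsAdjointPair B B e (L.dual hgr)) (hfe : LinearMap.IsAdjointPair B B (L.dual hgr) e) {γ : SL(2, K)}
    (hγ : γ.transpose * γ = 1) : B.IsOrthogonal (L.sl2Rep hgr γ) := fun x y ↦ by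
  rw [L.isAdjointPair_sl2Rep_transpose hgr hef hfe γ x (L.sl2Rep hgr γ y), ← Module.End.mul_apply, ← map_mul, hγ, map_one,
    Module.End.one_apply]

/-- **`γᵀ = γ ⇒ ρ(γ)` is `B`-self-adjoint** (symmetric matrices go to self-adjoint operators: the torus `diag(t, t⁻¹)`, the centre `−1`).
[cite: Andre1996Motifs, Prop. 1.2 (pp. 11–12)] -/
theorem isSelfAdjoint_sl2Rep_of_transpose_eq (L : HasLefschetzProperty h e) (hgr : IsZGrading h)
    (hef : LinearMap.IsAdjointPair B B e (L.dual hgr)) (hfe : LinearMap.IsAdjointPair B B (L.dual hgr) e) {γ : SL(2, K)}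
    (hγ : γ.transpose = γ) : B.IsSelfAdjoint (L.sl2Rep hgr γ) := by
  have key := L.isAdjointPair_sl2Rep_transpose hgr hef hfe γ
  rwa [hγ] at key

/-- **`wᵀ = w³` (`= w⁻¹`)**: the Weyl element `w = ρ(0 −1 ; 1 0)` and `w³ = ρ((0 −1 ; 1 0)ᵀ)` form a `B`-adjoint pair — the transpose of
`(0 −1 ; 1 0)` is its inverse `(0 1 ; −1 0) = (0 −1 ; 1 0)³`. [cite: Andre1996Motifs, §1.2 (p. 11, "l'élément (0 1 ; −1 0) de SL₂") and Prop. 1.2]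
[cite: Beauville2010SL2, §3 Theorem] -/
theorem isAdjointPair_weylOperator_pow_three (L : HasLefschetzProperty h e) (hgr : IsZGrading h)
    (hef : LinearMap.IsAdjointPair B B e (L.dual hgr)) (hfe : LinearMap.IsAdjointPair B B (L.dual hgr) e) :
    LinearMap.IsAdjointPair B B (L.weylOperator hgr) (⇑(L.weylOperator hgr ^ 3)) := by
  set S : SL(2, K) := ⟨!![0, -1; 1, 0], by rw [Matrix.det_fin_two_of]; ring⟩ with hS
  have hcoe : (S : Matrix (Fin 2) (Fin 2) K) = !![0, -1; 1, 0] := rfl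
  have hT : S.transpose = S * S * S := Subtype.ext <| by
    rw [Matrix.SpecialLinearGroup.coe_transpose, Matrix.SpecialLinearGroup.coe_mul, Matrix.SpecialLinearGroup.coe_mul, hcoe]
    ext i j
    fin_cases i <;> fin_cases j <;> simp [Matrix.mul_apply, Fin.sum_univ_two]
  have key := L.isAdjointPair_sl2Rep_transpose hgr hef hfe S
  rwa [hT, map_mul, map_mul, L.sl2Rep_apply_of_coe_eq_weyl hgr S hcoe, ← pow_three'] at key

/-- **THE WEYL ELEMENT IS A `B`-ISOMETRY: `B(w x, w y) = B(x, y)`** for every Weyl-type form (`wᵀ w = w³ w = w⁴ = 1`) — on a complex torus: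
`Q_w(w x, w y) = Q_w(x, y)` (`ComplexTorusWeylOperatorPolarizationIsometry`), i.e. Parseval for the normalised Fourier transform in Voisin's
normalisation. [cite: Andre1996Motifs, §1.2 and Prop. 1.2 (p. 11)] [cite: Beauville2010SL2, §3 Theorem] -/
theorem isOrthogonal_weylOperator (L : HasLefschetzProperty h e) (hgr : IsZGrading h)
    (hef : LinearMap.IsAdjointPair B B e (L.dual hgr)) (hfe : LinearMap.IsAdjointPair B B (L.dual hgr) e) :
    B.IsOrthogonal (L.weylOperator hgr) := fun x y ↦ by
  have h4 : L.weylOperator hgr ^ 3 * L.weylOperator hgr = 1 := by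
    rw [← L.weylOperator_pow_four hgr]; exact (pow_succ _ 3).symm
  rw [L.isAdjointPair_weylOperator_pow_three hgr hef hfe x (L.weylOperator hgr y), ← Module.End.mul_apply, h4, Module.End.one_apply]

/-- **`w²` is `B`-self-adjoint** (`w² = ρ(−1)` and `(−1)ᵀ = −1`; `w² = (−1)ʰ` is diagonal). [cite: Andre1996Motifs, §1.2 (p. 11)]
[cite: Beauville2010SL2, §3 Proposition (ii) ("h² = β(−I)")] -/
theorem isSelfAdjoint_weylOperator_sq (L : HasLefschetzProperty h e) (hgr : IsZGrading h)
    (hef : LinearMap.IsAdjointPair B B e (L.dual hgr)) (hfe : LinearMap.IsAdjointPair B B (L.dual hgr) e) :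
    B.IsSelfAdjoint ⇑(L.weylOperator hgr * L.weylOperator hgr) := by
  rw [← L.sl2Rep_neg_one hgr]
  exact L.isSelfAdjoint_sl2Rep_of_transpose_eq hgr hef hfe (Subtype.ext (by
    rw [Matrix.SpecialLinearGroup.coe_transpose, Matrix.SpecialLinearGroup.coe_neg, Matrix.SpecialLinearGroup.coe_one,
      Matrix.transpose_neg, Matrix.transpose_one]))

/-- **The torus `tʰ = ρ(diag(t, t⁻¹))` is `B`-self-adjoint** (`t ≠ 0`; a diagonal matrix is symmetric).
[cite: Andre1996Motifs, §1.2 (p. 11, "h ↦ (1 0 ; 0 −1)")] [cite: Beauville2010SL2, §3 Theorem] -/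
theorem isSelfAdjoint_torus (L : HasLefschetzProperty h e) (hgr : IsZGrading h)
    (hef : LinearMap.IsAdjointPair B B e (L.dual hgr)) (hfe : LinearMap.IsAdjointPair B B (L.dual hgr) e) {t : K} (ht : t ≠ 0) :
    B.IsSelfAdjoint (hgr.torus t) := by
  set D : SL(2, K) := ⟨!![t, 0; 0, t⁻¹], by rw [Matrix.det_fin_two_of, mul_inv_cancel₀ ht, mul_zero, sub_zero]⟩ with hD
  have hcoe : (D : Matrix (Fin 2) (Fin 2) K) = !![t, 0; 0, t⁻¹] := rfl
  rw [← L.sl2Rep_apply_of_coe_eq_diagonal hgr D hcoe]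
  refine L.isSelfAdjoint_sl2Rep_of_transpose_eq hgr hef hfe (Subtype.ext ?_)
  rw [Matrix.SpecialLinearGroup.coe_transpose, hcoe]
  ext i j
  fin_cases i <;> fin_cases j <;> simp

end HasLefschetzProperty

end WeylType

/-! ### §3 `K[e, f]` is stable under `B`-transposition -/

section Adjoin

omit [CharZero K] in
/-- **Generic**: if every generator `a ∈ S` has SOME `B`-adjoint inside the subalgebra `K[S]`, then every element of `K[S]` has one
(adjoints of sums are sums, of products are products in the opposite order; scalars are self-adjoint) — the form of André's "il suffit de
la tester sur les générateurs" needed when the generators are exchanged, rather than fixed, by transposition.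
[cite: Andre1996Motifs, Prop. 1.2 (p. 12, proof)] -/
theorem exists_isAdjointPair_of_mem_adjoin_of_forall_exists {S : Set (Module.End K M)}
    (hS : ∀ a ∈ S, ∃ a' ∈ Algebra.adjoin K S, LinearMap.IsAdjointPair B B a a') {T : Module.End K M} (hT : T ∈ Algebra.adjoin K S) :
    ∃ T' ∈ Algebra.adjoin K S, LinearMap.IsAdjointPair B B T T' := by
  induction hT using Algebra.adjoin_induction with
  | mem a ha => exact hS a ha
  | algebraMap r =>
    refine ⟨algebraMap K (Module.End K M) r, Subalgebra.algebraMap_mem _ r, fun x y ↦ ?_⟩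
    rw [Module.algebraMap_end_apply, Module.algebraMap_end_apply, map_smul, LinearMap.smul_apply, map_smul]
  | add a b _ _ ha hb =>
    obtain ⟨a', ha', haa⟩ := ha
    obtain ⟨b', hb', hbb⟩ := hb
    exact ⟨a' + b', Subalgebra.add_mem _ ha' hb', haa.add hbb⟩
  | mul a b _ _ ha hb =>
    obtain ⟨a', ha', haa⟩ := ha
    obtain ⟨b', hb', hbb⟩ := hb
    exact ⟨b' * a', Subalgebra.mul_mem _ hb' ha', haa.mul hbb⟩

/-- **`K[e, ᶜΛ]` IS STABLE UNDER TRANSPOSITION for a Weyl-type form**: every `T ∈ K[e, f]` has a `B`-adjoint `Tᵀ ∈ K[e, f]` (the generators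
`e`, `f` are exchanged by transposition). [cite: Andre1996Motifs, Prop. 1.2 (pp. 11–12)] -/
theorem HasLefschetzProperty.exists_isAdjointPair_of_mem_adjoin_pair_dual_of_isAdjointPair [FiniteDimensional K M]
    (L : HasLefschetzProperty h e) (hgr : IsZGrading h) (hef : LinearMap.IsAdjointPair B B e (L.dual hgr))
    (hfe : LinearMap.IsAdjointPair B B (L.dual hgr) e) {T : Module.End K M}
    (hT : T ∈ Algebra.adjoin K ({e, L.dual hgr} : Set (Module.End K M))) :
    ∃ T' ∈ Algebra.adjoin K ({e, L.dual hgr} : Set (Module.End K M)), LinearMap.IsAdjointPair B B T T' := by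
  refine exists_isAdjointPair_of_mem_adjoin_of_forall_exists ?_ hT
  rintro a (rfl | rfl)
  · exact ⟨L.dual hgr, Algebra.subset_adjoin (by simp), hef⟩
  · exact ⟨e, Algebra.subset_adjoin (by simp), hfe⟩

end Adjoin

/-! ### §4 Strings are `B`-orthogonal off the diagonal; the degree-`0` part of `K[e, f]` is self-adjoint -/

section Diagonal

namespace HasLefschetzProperty

variable [FiniteDimensional K M]

/-- `fʲ(eʲ p) = c · p` for `p ∈ P_{−a}` (iterate `f(e^{i+1} p) = (i+1)(a−i) eⁱ p`; the constant is `Π_{i<j} (i+1)(a−i)`, not needed here).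
[cite: Andre1996Motifs, §1.1 (p. 10, formula for ᶜΛ)] -/
private theorem exists_pow_dual_apply_pow_self₉₀ (L : HasLefschetzProperty h e) (hgr : IsZGrading h) {a : ℕ} {p : M}
    (hp : p ∈ primitiveSpace h e a) (j : ℕ) : ∃ c : K, (L.dual hgr ^ j) ((e ^ j) p) = c • p := by
  induction j with
  | zero => exact ⟨1, by rw [pow_zero, pow_zero, Module.End.one_apply, Module.End.one_apply, one_smul]⟩
  | succ j ih =>
    obtain ⟨c, hc⟩ := ih
    exact ⟨(((j + 1) * (a - j) : ℤ) : K) * c, by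
      rw [pow_succ (L.dual hgr), Module.End.mul_apply, L.dual_apply_pow_primitive hgr hp j, map_smul, hc, smul_smul]⟩

/-- `fᵏ(eʲ p) = 0` for `j < k` (`p ∈ P_{−a}`: the string below `eʲ p` has only `j` steps, then `f p = 0`).
[cite: Andre1996Motifs, §1.1 (p. 10)] -/
private theorem pow_dual_apply_pow_of_lt₉₀ (L : HasLefschetzProperty h e) (hgr : IsZGrading h) {a : ℕ} {p : M}
    (hp : p ∈ primitiveSpace h e a) {j k : ℕ} (hjk : j < k) : (L.dual hgr ^ k) ((e ^ j) p) = 0 := by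
  obtain ⟨d, rfl⟩ := Nat.exists_eq_add_of_lt hjk
  obtain ⟨c, hc⟩ := L.exists_pow_dual_apply_pow_self₉₀ hgr hp j
  rw [show j + d + 1 = (d + 1) + j by ring, pow_add, Module.End.mul_apply, hc, map_smul, pow_succ, Module.End.mul_apply,
    L.dual_apply_primitive hgr hp, map_zero, smul_zero]

/-- **STRING VECTORS ARE `B`-ORTHOGONAL OFF THE DIAGONAL**: for a Weyl-type form, `p ∈ P_{−k}`, `p' ∈ P_{−k'}`:
`B(eⁱ p, eⁱ' p') = 0` unless `k = k'` AND `i = i'` — different degrees pair to zero (`hᵀ = h`), and in equal degree `−k + 2i = −k' + 2i'` with,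
say, `i < i'`, `B(eⁱ p, eⁱ' p') = B(fⁱ' eⁱ p, p') = 0` (the string under `eⁱ p` is too short). So the pieces `eⁱ P_{−k}` of the decomposition
`M = ⊕_{k,i} eⁱ P_{−k}` are pairwise `B`-orthogonal: in André's matrix picture a Weyl-type form is block-DIAGONAL, where a Poincaré-type form
is block-ANTIdiagonal (`apply_pow_primitive_pow_primitive_eq_zero`: `i + i' = k`). [cite: Andre1996Motifs, Prop. 1.2 (pp. 11–12)]
[cite: GoodmanWallachGTM255, §4.1.5 (4.6)–(4.8)] -/
theorem apply_pow_primitive_pow_primitive_eq_zero_of_isAdjointPair (L : HasLefschetzProperty h e) (hgr : IsZGrading h)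
    (hef : LinearMap.IsAdjointPair B B e (L.dual hgr)) (hfe : LinearMap.IsAdjointPair B B (L.dual hgr) e)
    {k k' i i' : ℕ} {p p' : M} (hp : p ∈ primitiveSpace h e k) (hp' : p' ∈ primitiveSpace h e k') (hne : ¬(k = k' ∧ i = i')) :
    B ((e ^ i) p) ((e ^ i') p') = 0 := by
  have hpk := (mem_primitiveSpace_iff.1 hp).1
  have hpk' := (mem_primitiveSpace_iff.1 hp').1
  by_cases hdeg : (-(k : ℤ) + 2 * (i : ℕ)) = (-(k' : ℤ) + 2 * (i' : ℕ))
  · rcases lt_trichotomy i i' with hii | rfl | hii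
    · rw [← isAdjointPair_pow hfe i' ((e ^ i) p) p', L.pow_dual_apply_pow_of_lt₉₀ hgr hp hii, map_zero, LinearMap.zero_apply]
    · exact absurd ⟨by omega, rfl⟩ hne
    · rw [isAdjointPair_pow hef i p ((e ^ i') p'), L.pow_dual_apply_pow_of_lt₉₀ hgr hp' hii, map_zero]
  · exact apply_eq_zero_of_isSelfAdjoint_of_mem_degreeSpace (L.isSelfAdjoint_h_of_isAdjointPair hgr hef hfe) hdeg
      (L.pow_apply_mem hpk i) (L.pow_apply_mem hpk' i')

/-- **THE DEGREE-`0` PART OF `K[e, ᶜΛ]` IS SELF-ADJOINT for every Weyl-type form**: if `T ∈ K[e, f]` commutes with `h` — equivalently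
(`mem_adjoin_pair_dual_and_commute_iff_forall_exists_smul`) `T` acts on every piece `eᵃ P_{−k}` by a scalar `c_{k,a}`: `T` is a combination of
the Lefschetz–Künneth / Kleiman projectors — then `B(T x, y) = B(x, T y)` (test on strings: both sides are `c_{k,a} B(eᵃp, eᵃ'p')`, non-zero only
on the diagonal `(k, a) = (k', a')`). In André's matrix picture: diagonal matrices are symmetric. [cite: Andre1996Motifs, Prop. 1.2 (pp. 11–12:
"contiennent les projecteurs de Künneth" and "la transposition […] correspond à la transposition des matrices")] [cite: GoodmanWallachGTM255, §5.5.2 Cor. 5.5.16] -/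
theorem isSelfAdjoint_of_mem_adjoin_pair_dual_of_commute (L : HasLefschetzProperty h e) (hgr : IsZGrading h)
    (hef : LinearMap.IsAdjointPair B B e (L.dual hgr)) (hfe : LinearMap.IsAdjointPair B B (L.dual hgr) e) {T : Module.End K M}
    (hT : T ∈ Algebra.adjoin K ({e, L.dual hgr} : Set (Module.End K M))) (hTh : Commute h T) : B.IsSelfAdjoint T := by
  have hc := (L.mem_adjoin_pair_dual_and_commute_iff_forall_exists_smul hgr T).1 ⟨hT, hTh⟩
  choose c hc using hc
  refine isAdjointPair_of_strings L hgr fun k p hp j _ k' p' hp' j' _ ↦ ?_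
  rw [hc k j p hp, hc k' j' p' hp', map_smul, LinearMap.smul_apply, map_smul, smul_eq_mul, smul_eq_mul]
  by_cases hkj : k = k' ∧ j = j'
  · obtain ⟨rfl, rfl⟩ := hkj
    rfl
  · rw [L.apply_pow_primitive_pow_primitive_eq_zero_of_isAdjointPair hgr hef hfe hp hp' hkj, mul_zero, mul_zero]

/-- **The piece projectors `E⁽ᵏ⁾_{aa}` (onto `eᵃ P_{−k}` along the other pieces — the building blocks of Kleiman's `pʲ` and of the
Lefschetz–Künneth projectors) are `B`-self-adjoint** for every Weyl-type form. [cite: Andre1996Motifs, Prop. 1.2 (pp. 11–12)]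
[cite: GoodmanWallachGTM255, §4.1.5 (4.8)] -/
theorem isSelfAdjoint_stringUnit_diag (L : HasLefschetzProperty h e) (hgr : IsZGrading h)
    (hef : LinearMap.IsAdjointPair B B e (L.dual hgr)) (hfe : LinearMap.IsAdjointPair B B (L.dual hgr) e) (k a : ℕ) :
    B.IsSelfAdjoint (L.stringUnit hgr k a a) := by
  have h1 := (L.mem_adjoin_pair_dual_and_commute_iff_mem_span hgr (L.stringUnit hgr k a a)).2
    (Submodule.subset_span ⟨k, a, rfl⟩)
  exact L.isSelfAdjoint_of_mem_adjoin_pair_dual_of_commute hgr hef hfe h1.1 h1.2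

end HasLefschetzProperty

end Diagonal

/-! ### §5 André's form `(x, y) ↦ B(x, *_H y)` of a Poincaré-type pairing is of Weyl type (appended, row g49-#4) -/

section AndreForm

namespace HasLefschetzProperty

variable [FiniteDimensional K M]

/-- **ANDRÉ'S PROP. 1.2, LAST CLAUSE, FOR `* = *_H`, AT THE LEVEL OF THE GROUP: `B(ρ(γ) x, *_H y) = B(x, *_H ρ(γᵀ) y)` for every `γ ∈ SL₂(K)`** and every
Poincaré-type pairing `B` (`h` skew-adjoint, `e` self-adjoint — "`L` […] auto-adjoint"): for André's form `B⋆ = B(·, *_H ·)` the generators are exchanged by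
transposition (`isAdjointPair_compl₂_andreHodgeInvolution`: `eᵀ = ᶜΛ`; `…'`: `ᶜΛᵀ = e`), i.e. `B⋆` is of Weyl type, and §2 applies.
[cite: Andre1996Motifs, Prop. 1.2 (pp. 11–12, "la transposition relative à la forme bilinéaire (x, y) ↦ ∫ x ∪ *y correspond à la transposition des matrices,
pour * = *_L ou *_H")] [cite: Beauville2010SL2, §3 Theorem] -/
theorem isAdjointPair_compl₂_andreHodgeInvolution_sl2Rep_transpose (L : HasLefschetzProperty h e) (hgr : IsZGrading h) (hh : B.IsSkewAdjoint h)
    (he : B.IsSelfAdjoint e) (d : ℕ) (γ : SL(2, K)) :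
    LinearMap.IsAdjointPair (B.compl₂ (L.andreHodgeInvolution hgr d)) (B.compl₂ (L.andreHodgeInvolution hgr d)) (L.sl2Rep hgr γ)
      (L.sl2Rep hgr γ.transpose) :=
  L.isAdjointPair_sl2Rep_transpose hgr (L.isAdjointPair_compl₂_andreHodgeInvolution hgr d he) (L.isAdjointPair_compl₂_andreHodgeInvolution' hgr d hh he) γ

/-- Pointwise: **`B(ρ(γ) x, *_H y) = B(x, *_H (ρ(γᵀ) y))`**. [cite: Andre1996Motifs, Prop. 1.2 (pp. 11–12)] -/
theorem apply_sl2Rep_andreHodgeInvolution_eq (L : HasLefschetzProperty h e) (hgr : IsZGrading h) (hh : B.IsSkewAdjoint h) (he : B.IsSelfAdjoint e) (d : ℕ)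
    (γ : SL(2, K)) (x y : M) :
    B (L.sl2Rep hgr γ x) (L.andreHodgeInvolution hgr d y) = B x (L.andreHodgeInvolution hgr d (L.sl2Rep hgr γ.transpose y)) :=
  L.isAdjointPair_compl₂_andreHodgeInvolution_sl2Rep_transpose hgr hh he d γ x y

/-- **`h` is self-adjoint for André's form**: `B(h x, *_H y) = B(x, *_H (h y))` (`hᵀ = −h` for `B` and `*_H h = −h *_H`). [cite: Andre1996Motifs, §1.2 (p. 11)] -/
theorem isSelfAdjoint_compl₂_andreHodgeInvolution_h (L : HasLefschetzProperty h e) (hgr : IsZGrading h) (hh : B.IsSkewAdjoint h) (he : B.IsSelfAdjoint e)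
    (d : ℕ) : (B.compl₂ (L.andreHodgeInvolution hgr d)).IsSelfAdjoint h :=
  L.isSelfAdjoint_h_of_isAdjointPair hgr (L.isAdjointPair_compl₂_andreHodgeInvolution hgr d he) (L.isAdjointPair_compl₂_andreHodgeInvolution' hgr d hh he)

/-- **`γᵀγ = 1 ⇒ B(ρ(γ) x, *_H ρ(γ) y) = B(x, *_H y)`** (the Weyl element, `−1`, the rotations act by isometries of André's form).
[cite: Andre1996Motifs, Prop. 1.2 (pp. 11–12)] [cite: LooijengaLunts1997, §1 (1.3) p. 5] -/
theorem isOrthogonal_compl₂_andreHodgeInvolution_sl2Rep_of_transpose_mul_self (L : HasLefschetzProperty h e) (hgr : IsZGrading h)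
    (hh : B.IsSkewAdjoint h) (he : B.IsSelfAdjoint e) (d : ℕ) {γ : SL(2, K)} (hγ : γ.transpose * γ = 1) :
    (B.compl₂ (L.andreHodgeInvolution hgr d)).IsOrthogonal (L.sl2Rep hgr γ) :=
  L.isOrthogonal_sl2Rep_of_transpose_mul_self hgr (L.isAdjointPair_compl₂_andreHodgeInvolution hgr d he)
    (L.isAdjointPair_compl₂_andreHodgeInvolution' hgr d hh he) hγ

/-- **The Weyl element is an isometry of André's form: `B(w x, *_H w y) = B(x, *_H y)`.** [cite: Andre1996Motifs, §1.2 and Prop. 1.2 (p. 11)] -/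
theorem isOrthogonal_compl₂_andreHodgeInvolution_weylOperator (L : HasLefschetzProperty h e) (hgr : IsZGrading h) (hh : B.IsSkewAdjoint h)
    (he : B.IsSelfAdjoint e) (d : ℕ) : (B.compl₂ (L.andreHodgeInvolution hgr d)).IsOrthogonal (L.weylOperator hgr) :=
  L.isOrthogonal_weylOperator hgr (L.isAdjointPair_compl₂_andreHodgeInvolution hgr d he) (L.isAdjointPair_compl₂_andreHodgeInvolution' hgr d hh he)

/-- **The pieces `eⁱ P_{−k}` are orthogonal for André's form**: `B(eⁱ p, *_H (eⁱ' p')) = 0` unless `k = k'` and `i = i'` (`p ∈ P_{−k}`, `p' ∈ P_{−k'}`) — André's form is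
block-DIAGONAL on the Lefschetz decomposition, where the Poincaré pairing itself is block-antidiagonal. [cite: Andre1996Motifs, Prop. 1.2 (pp. 11–12)] -/
theorem apply_pow_primitive_andreHodgeInvolution_pow_primitive_eq_zero (L : HasLefschetzProperty h e) (hgr : IsZGrading h) (hh : B.IsSkewAdjoint h)
    (he : B.IsSelfAdjoint e) (d : ℕ) {k k' i i' : ℕ} {p p' : M} (hp : p ∈ primitiveSpace h e k) (hp' : p' ∈ primitiveSpace h e k')
    (hne : ¬(k = k' ∧ i = i')) : B ((e ^ i) p) (L.andreHodgeInvolution hgr d ((e ^ i') p')) = 0 :=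
  L.apply_pow_primitive_pow_primitive_eq_zero_of_isAdjointPair hgr (B := B.compl₂ (L.andreHodgeInvolution hgr d))
    (L.isAdjointPair_compl₂_andreHodgeInvolution hgr d he) (L.isAdjointPair_compl₂_andreHodgeInvolution' hgr d hh he) hp hp' hne

/-- **The degree-`0` part of `K[e, ᶜΛ]` is symmetric for André's form**: `B(T x, *_H y) = B(x, *_H (T y))` for `T ∈ K[e, f]` commuting with `h` (Kleiman's `pʲ`,
the Lefschetz–Künneth projectors: "contiennent les projecteurs de Künneth" + "la transposition […] correspond à la transposition des matrices").
[cite: Andre1996Motifs, Prop. 1.2 (pp. 11–12)] -/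
theorem isSelfAdjoint_compl₂_andreHodgeInvolution_of_mem_adjoin_pair_dual_of_commute (L : HasLefschetzProperty h e) (hgr : IsZGrading h)
    (hh : B.IsSkewAdjoint h) (he : B.IsSelfAdjoint e) (d : ℕ) {T : Module.End K M} (hT : T ∈ Algebra.adjoin K ({e, L.dual hgr} : Set (Module.End K M)))
    (hTh : Commute h T) : (B.compl₂ (L.andreHodgeInvolution hgr d)).IsSelfAdjoint T :=
  L.isSelfAdjoint_of_mem_adjoin_pair_dual_of_commute hgr (L.isAdjointPair_compl₂_andreHodgeInvolution hgr d he)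
    (L.isAdjointPair_compl₂_andreHodgeInvolution' hgr d hh he) hT hTh

end HasLefschetzProperty

end AndreForm

end Literature.Algebra.Lie
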